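import Summits.BirchSwinnertonDyer.BirchSwinnertonDyer.Theorems.KolyvaginRoadThreeZhangInductionOn
import HarnessLib

/-!
# Route `KolyvaginRoadThree`, deciding crux `ZhangSharpFrameAtThreeHL` (item stmt-BirchSwinnertonDyer-19574):
# W. Zhang's induction on good levels asks the TRIANGULATION (A3) only ABOVE the bottom level
# (cell `bsd-stepL`, ACCEL seat `bsd-stepL-koly3b` g2; `--supports stmt-BirchSwinnertonDyer-19574`, helper; companion of
# `KolyvaginRoadThreeZhangInductionOn.lean`, zhang3-p1 g5 p455609)

HONEST FRAMING. Pure linear algebra over an arbitrary field; nothing about elliptic curves, Heegner points or `p = 3`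
is asserted; 0 defs, 0 facts, 0 `sorry`. PARTITION: O2@3 (B10) × A1 × crux 19574 — none (composition engine; types
nothing, closes nothing; T7).

WHY. In the relativised engine `ZhangInductionOn.exists_ne_zero_of_zhangInduction_on` (the `_of` of the registered
METHOD skeleton `Method2` of crux 19574, versions v2t ∕ v2u ∕ v2w ∕ v2x, calls it) the input shape (A3) — W. Zhang's
Lemma 8.4 (1)+(3), the triangulation of the Selmer group at a level `n` carrying a non-zero Kolyvagin class — is
INSTANTIATED only at the level `n ∪ {q₁, q₂}` reached after two rank-lowering steps (Camb. J. Math. 2 (2014), p. 241: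
Lemma 8.4 is applied to the system `κ_{q₁q₂}` of the level-raised form `g₂`, never to `κ` itself). Hence the induction
needs (A3) only at levels of POSITIVE cardinality; at the bottom level `∅` (where, in the method skeleton, the classes
are PINNED to the concrete Kolyvagin classes `c(m) ∈ H¹(K, E[3])` and (A3) is a genuine statement about `Sel₃(E/K)` and
the base locus of the concrete system) it is IDLE. This file records the fact at the engine level: the three theorems
below are `exists_ne_zero_of_zhangInduction_on`, `…_of_rank_ne_zero` and `exists_ne_zero_at_bottom_…` of the companion
file VERBATIM, except that the hypothesis `hA3` carries the extra binder `n.Nonempty`. The proofs are zhang3-p1's,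
verbatim, with `Finset.insert_nonempty` supplied at the one call site. Consumers: the registered stub
`Method2.stub_kolyvaginClassesAtThree` may drop its (A3) conjunct at `n = ∅` (see the companion helper
`KolyvaginRoadThreeMethod2ClassesFromBottom.lean` of this seat for what the remaining conjuncts are worth).

References: [cite: WZhang2014, §9 proof of Thm. 9.1 (pp. 240–242), Lemma 8.4, Prop. 5.4, Thm. 4.3, Thm. 7.2, Thm. 9.2].
-/

namespace Summit.BirchSwinnertonDyer.Rank1Residual.X11b.Three.Koly.ZhangInductionOnPos

open Module

variable {F : Type*} [Field F] {H : Type*} [AddCommGroup H] [Module F H]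
  {Q : Type*} [DecidableEq Q] {M : Type*}

/-- A submodule of positive dimension has a non-zero element. [folklore] -/
private theorem exists_mem_ne_zero_of_finrank_pos {S : Submodule F H} (h : 0 < finrank F S) :
    ∃ c ∈ S, c ≠ 0 := by
  by_contra hc
  push Not at hc
  have hbot : S = ⊥ := (Submodule.eq_bot_iff S).mpr hc
  rw [hbot, finrank_bot] at h
  exact lt_irrefl 0 h

omit [DecidableEq Q] in
/-- The total rank does not depend on which eigenspace is listed first. [folklore] -/
private theorem rank_symm (Sel : Finset Q → Bool → Submodule F H) (n : Finset Q) (μ : Bool) :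
    finrank F (Sel n μ) + finrank F (Sel n (!μ)) = finrank F (Sel n true) + finrank F (Sel n false) := by
  cases μ
  · rw [Bool.not_false, add_comm]
  · rw [Bool.not_true]

set_option maxHeartbeats 400000 in
/-- **Zhang's induction on GOOD levels, triangulation asked only at NON-EMPTY levels** (Camb. J. Math. 2 (2014), proof
of Thm. 9.1, relativised; = `ZhangInductionOn.exists_ne_zero_of_zhangInduction_on` with `hA3` restricted to
`n.Nonempty`). Data: a predicate `Good` on levels, eigen-Selmer spaces `Sel n ±`, relaxed spaces `SelRel n S ±`, a base
locus `B n`, classes `κ m n`, a bottom index `m₁`; (A1) rank lowering producing good levels, (A2) congruence transport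
along two good steps, (A3) triangulation at good even levels OF POSITIVE CARDINALITY carrying a non-zero class, (A4)
relaxation, (A5) base case, (A6) parity. Conclusion: a non-zero class at every good even level. Proof = Zhang's: lower
the rank twice inside the larger eigenspace, apply the induction hypothesis at `n ∪ {q₁, q₂}` — a NON-EMPTY level, the
only place (A3) is used — and transport back by (A2) unless `q₂` is a base point, which (A3) + (A4) exclude.
[cite: WZhang2014, §9 proof of Thm. 9.1, Lemma 8.4, Prop. 5.4, Thm. 4.3, Thm. 7.2, Thm. 9.2] -/
theorem exists_ne_zero_of_zhangInduction_on_pos (Good : Finset Q → Prop)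
    (Sel : Finset Q → Bool → Submodule F H) (SelRel : Finset Q → Set Q → Bool → Submodule F H)
    (B : Finset Q → Set Q) (κ : M → Finset Q → H) (m₁ : M)
    -- (A1) rank lowering at a fresh prime, staying inside the good levels, eigen-bookkeeping (9.1)–(9.2)
    (hA1 : ∀ (n : Finset Q) (μ : Bool) (c : H), Good n → c ∈ Sel n μ → c ≠ 0 →
      ∃ q, q ∉ n ∧ Good (insert q n) ∧ c ∉ Sel (insert q n) μ ∧ Sel (insert q n) μ ≤ Sel n μ ∧
        finrank F (Sel (insert q n) μ) + 1 = finrank F (Sel n μ) ∧ Sel (insert q n) (!μ) = Sel n (!μ))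
    -- (A2) cohomological congruence, contrapositive form, along two good lowering steps
    (hA2 : ∀ (n : Finset Q) (q₁ q₂ : Q), Good n → Good (insert q₁ n) → Good (insert q₂ (insert q₁ n)) →
      q₁ ∉ n → q₂ ∉ insert q₁ n → q₂ ∉ B (insert q₂ (insert q₁ n)) → ∃ m, κ m n ≠ 0)
    -- (A3) triangulation at a good even level OF POSITIVE CARDINALITY carrying a non-zero class
    (hA3 : ∀ (n : Finset Q), Good n → n.Nonempty → Even n.card → (∃ m, κ m n ≠ 0) →
      ∃ (s : Bool) (d : ℕ), finrank F (Sel n s) = d + 1 ∧ Sel n s = SelRel n (B n) s ∧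
        FiniteDimensional F (SelRel n (B n) (!s)) ∧ finrank F (SelRel n (B n) (!s)) ≤ d)
    -- (A4) relaxation: good levels n and n ∪ {q} differ only at q
    (hA4 : ∀ (n : Finset Q) (q : Q) (S : Set Q) (s : Bool), Good n → Good (insert q n) → q ∉ n → q ∈ S →
      Sel n s ≤ SelRel (insert q n) S s)
    -- (A5) base case at good even levels: Selmer rank one
    (hA5 : ∀ (n : Finset Q), Good n → Even n.card →
      finrank F (Sel n true) + finrank F (Sel n false) = 1 → κ m₁ n ≠ 0)
    -- (A6) parity at good even levels
    (hA6 : ∀ (n : Finset Q), Good n → Even n.card → Odd (finrank F (Sel n true) + finrank F (Sel n false))) :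
    ∀ (n : Finset Q), Good n → Even n.card → ∃ m, κ m n ≠ 0 := by
  suffices hmain : ∀ (k : ℕ) (n : Finset Q), Good n → finrank F (Sel n true) + finrank F (Sel n false) = k →
      Even n.card → ∃ m, κ m n ≠ 0 from fun n hg hn ↦ hmain _ n hg rfl hn
  intro k
  induction k using Nat.strong_induction_on with
  | _ k ih =>
    intro n hg hk hn
    have hodd := hA6 n hg hn
    by_cases h1 : finrank F (Sel n true) + finrank F (Sel n false) = 1
    · exact ⟨m₁, hA5 n hg hn h1⟩
    have h3 : 3 ≤ finrank F (Sel n true) + finrank F (Sel n false) := by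
      obtain ⟨t, ht⟩ := hodd
      omega
    obtain ⟨μ, hμ⟩ : ∃ μ : Bool, finrank F (Sel n (!μ)) < finrank F (Sel n μ) := by
      by_cases hlt : finrank F (Sel n false) < finrank F (Sel n true)
      · exact ⟨true, by rw [Bool.not_true]; exact hlt⟩
      · refine ⟨false, ?_⟩
        have hne : finrank F (Sel n true) ≠ finrank F (Sel n false) := by
          intro heq
          obtain ⟨t, ht⟩ := hodd
          omega
        rw [Bool.not_false]
        omega
    have hsum := rank_symm Sel n μ
    have hμ2 : 2 ≤ finrank F (Sel n μ) := by omega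
    -- first rank lowering, at q₁ (the new level is good)
    obtain ⟨c₁, hc₁, hc₁0⟩ := exists_mem_ne_zero_of_finrank_pos (S := Sel n μ) (by omega)
    obtain ⟨q₁, hq₁n, hg₁, -, -, hrk₁, hneg₁⟩ := hA1 n μ c₁ hg hc₁ hc₁0
    -- second rank lowering, at q₂, killing a non-zero c₂ ∈ Sel (n ∪ {q₁}) μ (the new level is good)
    obtain ⟨c₂, hc₂, hc₂0⟩ := exists_mem_ne_zero_of_finrank_pos (S := Sel (insert q₁ n) μ) (by omega)
    obtain ⟨q₂, hq₂n, hg₂, hc₂out, hle₂, hrk₂, hneg₂⟩ := hA1 (insert q₁ n) μ c₂ hg₁ hc₂ hc₂0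
    set n₁ := insert q₁ n with hn₁
    set n₂ := insert q₂ n₁ with hn₂
    have hne₂ : n₂.Nonempty := Finset.insert_nonempty q₂ n₁
    have hcard : n₂.card = n.card + 2 := by
      rw [hn₂, Finset.card_insert_of_notMem hq₂n, hn₁, Finset.card_insert_of_notMem hq₁n]
    have hn₂even : Even n₂.card := by
      obtain ⟨t, ht⟩ := hn
      exact ⟨t + 1, by rw [hcard]; omega⟩
    have hsum₂ := rank_symm Sel n₂ μ
    have hrank₂ : finrank F (Sel n₂ true) + finrank F (Sel n₂ false) + 2 = k := by
      rw [← hsum₂, hneg₂, hneg₁, ← hk, ← hsum]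
      omega
    obtain ⟨m', hm'⟩ := ih _ (by omega) n₂ hg₂ rfl hn₂even
    -- transport down by (A2) unless q₂ is a base point of the level-n₂ system
    refine hA2 n q₁ q₂ hg hg₁ hg₂ hq₁n hq₂n fun hq₂B ↦ ?_
    -- (A3) is used HERE ONLY: at the non-empty level n₂
    obtain ⟨s, d, hs1, hs2, hs3fin, hs3⟩ := hA3 n₂ hg₂ hne₂ hn₂even ⟨m', hm'⟩
    by_cases hsμ : s = μ
    · -- case (1): the killed class c₂ would lie in Sel n₂ μ
      subst hsμ
      have hincl : Sel n₁ s ≤ SelRel n₂ (B n₂) s := hA4 n₁ q₂ (B n₂) s hg₁ hg₂ hq₂n hq₂B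
      exact hc₂out (hs2 ▸ hincl hc₂)
    · -- case (2): dimension count (9.1)–(9.4)
      have hs : s = !μ := by cases s <;> cases μ <;> simp_all
      subst hs
      have hincl : Sel n₁ μ ≤ SelRel n₂ (B n₂) μ := hA4 n₁ q₂ (B n₂) μ hg₁ hg₂ hq₂n hq₂B
      have hfin' : FiniteDimensional F (SelRel n₂ (B n₂) μ) := by
        rw [Bool.not_not] at hs3fin
        exact hs3fin
      have hle : finrank F (Sel n₁ μ) ≤ finrank F (SelRel n₂ (B n₂) μ) := Submodule.finrank_mono hincl
      have hs3' : finrank F (SelRel n₂ (B n₂) μ) ≤ d := by rw [Bool.not_not] at hs3; exact hs3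
      rw [hneg₂, hneg₁] at hs1
      omega

/-- **Zhang's induction on good levels with parity DERIVED, triangulation only at non-empty levels**: (A1)–(A5) on
good levels ((A3) at levels of positive cardinality only) and (A6⁰) «the Selmer rank at a good even level is non-zero»
give a non-zero class at every good even level (parity from `ZhangInductionOn.odd_rank_of_rankLowering_on`).
[cite: WZhang2014, §9 proof of Thm. 9.1 and Thm. 9.2] -/
theorem exists_ne_zero_of_zhangInduction_on_pos_of_rank_ne_zero (Good : Finset Q → Prop)
    (Sel : Finset Q → Bool → Submodule F H) (SelRel : Finset Q → Set Q → Bool → Submodule F H)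
    (B : Finset Q → Set Q) (κ : M → Finset Q → H) (m₁ : M)
    (hA1 : ∀ (n : Finset Q) (μ : Bool) (c : H), Good n → c ∈ Sel n μ → c ≠ 0 →
      ∃ q, q ∉ n ∧ Good (insert q n) ∧ c ∉ Sel (insert q n) μ ∧ Sel (insert q n) μ ≤ Sel n μ ∧
        finrank F (Sel (insert q n) μ) + 1 = finrank F (Sel n μ) ∧ Sel (insert q n) (!μ) = Sel n (!μ))
    (hA2 : ∀ (n : Finset Q) (q₁ q₂ : Q), Good n → Good (insert q₁ n) → Good (insert q₂ (insert q₁ n)) →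
      q₁ ∉ n → q₂ ∉ insert q₁ n → q₂ ∉ B (insert q₂ (insert q₁ n)) → ∃ m, κ m n ≠ 0)
    (hA3 : ∀ (n : Finset Q), Good n → n.Nonempty → Even n.card → (∃ m, κ m n ≠ 0) →
      ∃ (s : Bool) (d : ℕ), finrank F (Sel n s) = d + 1 ∧ Sel n s = SelRel n (B n) s ∧
        FiniteDimensional F (SelRel n (B n) (!s)) ∧ finrank F (SelRel n (B n) (!s)) ≤ d)
    (hA4 : ∀ (n : Finset Q) (q : Q) (S : Set Q) (s : Bool), Good n → Good (insert q n) → q ∉ n → q ∈ S →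
      Sel n s ≤ SelRel (insert q n) S s)
    (hA5 : ∀ (n : Finset Q), Good n → Even n.card →
      finrank F (Sel n true) + finrank F (Sel n false) = 1 → κ m₁ n ≠ 0)
    (hA6₀ : ∀ (n : Finset Q), Good n → Even n.card → finrank F (Sel n true) + finrank F (Sel n false) ≠ 0) :
    ∀ (n : Finset Q), Good n → Even n.card → ∃ m, κ m n ≠ 0 :=
  exists_ne_zero_of_zhangInduction_on_pos Good Sel SelRel B κ m₁ hA1 hA2 hA3 hA4 hA5
    (ZhangInductionOn.odd_rank_of_rankLowering_on Good Sel hA1 hA6₀)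

/-- **At the bottom level**: if `∅` is good, (A1)–(A6) relativised to good levels — with the triangulation (A3) asked
only at levels of POSITIVE cardinality — give a non-zero class `κ m ∅`. [cite: WZhang2014, Thm. 9.1] -/
theorem exists_ne_zero_at_bottom_of_zhangInduction_on_pos (Good : Finset Q → Prop) (hgood : Good ∅)
    (Sel : Finset Q → Bool → Submodule F H) (SelRel : Finset Q → Set Q → Bool → Submodule F H)
    (B : Finset Q → Set Q) (κ : M → Finset Q → H) (m₁ : M)
    (hA1 : ∀ (n : Finset Q) (μ : Bool) (c : H), Good n → c ∈ Sel n μ → c ≠ 0 →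
      ∃ q, q ∉ n ∧ Good (insert q n) ∧ c ∉ Sel (insert q n) μ ∧ Sel (insert q n) μ ≤ Sel n μ ∧
        finrank F (Sel (insert q n) μ) + 1 = finrank F (Sel n μ) ∧ Sel (insert q n) (!μ) = Sel n (!μ))
    (hA2 : ∀ (n : Finset Q) (q₁ q₂ : Q), Good n → Good (insert q₁ n) → Good (insert q₂ (insert q₁ n)) →
      q₁ ∉ n → q₂ ∉ insert q₁ n → q₂ ∉ B (insert q₂ (insert q₁ n)) → ∃ m, κ m n ≠ 0)
    (hA3 : ∀ (n : Finset Q), Good n → n.Nonempty → Even n.card → (∃ m, κ m n ≠ 0) →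
      ∃ (s : Bool) (d : ℕ), finrank F (Sel n s) = d + 1 ∧ Sel n s = SelRel n (B n) s ∧
        FiniteDimensional F (SelRel n (B n) (!s)) ∧ finrank F (SelRel n (B n) (!s)) ≤ d)
    (hA4 : ∀ (n : Finset Q) (q : Q) (S : Set Q) (s : Bool), Good n → Good (insert q n) → q ∉ n → q ∈ S →
      Sel n s ≤ SelRel (insert q n) S s)
    (hA5 : ∀ (n : Finset Q), Good n → Even n.card →
      finrank F (Sel n true) + finrank F (Sel n false) = 1 → κ m₁ n ≠ 0)
    (hA6 : ∀ (n : Finset Q), Good n → Even n.card → Odd (finrank F (Sel n true) + finrank F (Sel n false))) :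
    ∃ m, κ m ∅ ≠ 0 :=
  exists_ne_zero_of_zhangInduction_on_pos Good Sel SelRel B κ m₁ hA1 hA2 hA3 hA4 hA5 hA6 ∅ hgood (by simp)

end Summit.BirchSwinnertonDyer.Rank1Residual.X11b.Three.Koly.ZhangInductionOnPos
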